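import Mathlib
import Literature.Analysis.FluidPDE.TypeIICoreWitness
import Literature.Analysis.FluidPDE.SuitableWeak
import Summits.NavierStokesRegularity.NavierStokesRegularity.Theorems.TypeIIInviscidRelaxationMonopoleCoreExclusionAnchorObstruction
import HarnessLib

/-!
# Crux `MonopoleCoreExclusion` (stmt-1965): the residual of the anchor stub `stub_anchoredLateAxisymWitness`
# (LATENESS and a CORE-RADIUS FLOOR) is NOT a consequence of the axisymmetric witness clauses — the explicit family

`--supports stmt-NavierStokesRegularity-1965` (helper file, negative side; theorems only, no definitions, no `sorry`).
Axisymmetric twin of `CoreExclusionAnchorObstruction.exists_columnarWitnesses_never_late` (p832090), built on the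
obstruction theorem `MonopoleAnchorObstruction.mul_sub_one_lt_of_shellSpoiler`.

`MonopoleAnchorObstruction.exists_axisymWitnesses_never_late`: an explicit kinematic family `u : ℝ → ℝ³ → ℝ³` (NOT
a Navier–Stokes solution) — at time `t`, `s = 1 - t`: the axisymmetric cone core of radius `a = s²/24` and speed
`s⁻³` at the origin plus the spoiler shell `s/6 ≤ ‖x‖ ≤ s/3` carrying `(s⁻³/3)·e_x` — such that (i) `u` carries
level-`K` AXISYMMETRIC core witnesses (`TypeIICoreWitness IsAxisymmetric 1 K u t`) at every level `K > 0`
frequently before `T = 1` (the hypothesis `hw` of crux `MonopoleCoreExclusion` / of the anchor stub, verbatim, at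
`ν = 1`); (ii) `¬ IsTypeIBlowup u 1`; (iii) for every `K ≥ 25` and `0 < t < 1` EVERY datum `(x₀, L, V, Q, W)` with
`W` axisymmetric satisfying the speed-bound, near-maximum and level-`K` closeness clauses has `K·L ≤ 1 - t` (no
radius floor) and `K·L < (1 - t)·V` (never late); (iv) the "late level-`25` axisymmetric witnesses frequently"
statement fails.  So, as for the columnar class, lateness and the floor (the exact residual of the anchor stubs after
`CoreExclusionAnchor.anchoredLateWitness_of_lateWitnesses_radiusFloor`, p831087) must come from the Navier–Stokes
dynamics.  Nothing about Navier–Stokes regularity is claimed; no stub or crux is proved or refuted here.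
-/

noncomputable section

open Set Metric Filter Topology
open Literature.Analysis Literature.Analysis.FluidPDE

namespace Summit.NavierStokesRegularity.NavierStokesRegularity.Theorems

-- the problem directory repeats the summit name (`NavierStokesRegularity/NavierStokesRegularity`)
set_option linter.dupNamespace false

namespace MonopoleAnchorObstruction

/-- `‖e_z‖ = 1` (file-local copy). [folklore] -/
private theorem norm_eZ'' : ‖(eZ : EuclideanSpace ℝ (Fin 3))‖ = 1 := by
  simp [eZ]

/-- Rotations about the axis fix the multiples of `e_z`. [folklore] -/
theorem rotZ_smul_eZ (θ c : ℝ) : rotZ θ (c • (eZ : EuclideanSpace ℝ (Fin 3))) = c • eZ := by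
  ext i
  fin_cases i <;> simp [eZ]

/-- The radial cone profile `y ↦ max 0 (1 - ‖y‖) • e_z` is axisymmetric. [folklore] -/
theorem isAxisymmetric_radialCone :
    IsAxisymmetric (fun y : EuclideanSpace ℝ (Fin 3) => max 0 (1 - ‖y‖) • (eZ : EuclideanSpace ℝ (Fin 3))) := by
  intro θ y
  simp only [norm_rotZ, rotZ_smul_eZ]

/-- **Axisymmetric witness clauses do not force lateness or a core-radius floor** (kinematic obstruction for the
anchor stub of crux `MonopoleCoreExclusion`; see the module docstring for the family and the reading). [folklore] -/
theorem exists_axisymWitnesses_never_late :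
    ∃ u : ℝ → EuclideanSpace ℝ (Fin 3) → EuclideanSpace ℝ (Fin 3),
      (∀ K : ℝ, 0 < K → ∀ t₀ < (1 : ℝ), ∃ t, t₀ < t ∧ t < 1 ∧ TypeIICoreWitness IsAxisymmetric 1 K u t) ∧
      ¬ IsTypeIBlowup u 1 ∧
      (∀ (K t : ℝ), 25 ≤ K → 0 < t → t < 1 →
        ∀ (x₀ : EuclideanSpace ℝ (Fin 3)) (L V : ℝ)
          (Q : EuclideanSpace ℝ (Fin 3) ≃ₗᵢ[ℝ] EuclideanSpace ℝ (Fin 3))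
          (W : EuclideanSpace ℝ (Fin 3) → EuclideanSpace ℝ (Fin 3)),
          0 < L → 0 < V → IsAxisymmetric W → (∀ x, ‖u t x‖ ≤ V) →
          (∃ x₁, dist x₁ x₀ ≤ L ∧ V ≤ 2 * ‖u t x₁‖) →
          (∀ y : EuclideanSpace ℝ (Fin 3), ‖y‖ ≤ K →
            ‖V⁻¹ • Q.symm (u t (x₀ + L • Q y)) - W y‖ ≤ K⁻¹) →
          K * L ≤ 1 - t ∧ K * L < (1 - t) * V) ∧
      ¬ (∀ t₀ < (1 : ℝ), ∃ t, t₀ < t ∧ t < 1 ∧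
        ∃ (x₀ : EuclideanSpace ℝ (Fin 3)) (L V : ℝ)
          (Q : EuclideanSpace ℝ (Fin 3) ≃ₗᵢ[ℝ] EuclideanSpace ℝ (Fin 3))
          (W : EuclideanSpace ℝ (Fin 3) → EuclideanSpace ℝ (Fin 3)),
          0 < L ∧ 0 < V ∧ IsAxisymmetric W ∧ (∀ x, ‖u t x‖ ≤ V) ∧
          (∃ x₁, dist x₁ x₀ ≤ L ∧ V ≤ 2 * ‖u t x₁‖) ∧
          (∃ y y' : EuclideanSpace ℝ (Fin 3), ‖y‖ ≤ 1 ∧ ‖y'‖ ≤ 1 ∧ (4 : ℝ)⁻¹ ≤ ‖W y - W y'‖) ∧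
          25 * (1 : ℝ) ≤ L * V ∧
          (∀ y : EuclideanSpace ℝ (Fin 3), ‖y‖ ≤ 25 →
            ‖V⁻¹ • Q.symm (u t (x₀ + L • Q y)) - W y‖ ≤ (25 : ℝ)⁻¹) ∧
          (1 - t) * V ≤ 25 * L) := by
  set G : EuclideanSpace ℝ (Fin 3) → EuclideanSpace ℝ (Fin 3) :=
    fun y => max 0 (1 - ‖y‖) • (eZ : EuclideanSpace ℝ (Fin 3)) with hG
  set u : ℝ → EuclideanSpace ℝ (Fin 3) → EuclideanSpace ℝ (Fin 3) :=
    fun t x => if ‖x‖ ≤ (1 - t) ^ 2 / 24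
      then ((1 - t)⁻¹ ^ 3 * max 0 (1 - ‖x‖ / ((1 - t) ^ 2 / 24))) • (eZ : EuclideanSpace ℝ (Fin 3))
      else if (1 - t) / 6 ≤ ‖x‖ ∧ ‖x‖ ≤ 2 * ((1 - t) / 6)
        then ((1 - t)⁻¹ ^ 3 / 3) • EuclideanSpace.single 0 1 else 0 with hu
  -- the four region clauses of the slice `u t`, `0 < t < 1`
  have hcl : ∀ t : ℝ, 0 < t → t < 1 →
      (∀ x : EuclideanSpace ℝ (Fin 3), ‖x‖ ≤ (1 - t) ^ 2 / 24 →
        u t x = ((1 - t)⁻¹ ^ 3 * max 0 (1 - ‖x‖ / ((1 - t) ^ 2 / 24))) • (eZ : EuclideanSpace ℝ (Fin 3))) ∧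
      (∀ x : EuclideanSpace ℝ (Fin 3), (1 - t) ^ 2 / 24 < ‖x‖ → ‖x‖ < (1 - t) / 6 → u t x = 0) ∧
      (∀ x : EuclideanSpace ℝ (Fin 3), (1 - t) / 6 ≤ ‖x‖ → ‖x‖ ≤ 2 * ((1 - t) / 6) →
        u t x = ((1 - t)⁻¹ ^ 3 / 3) • EuclideanSpace.single 0 1) ∧
      (∀ x : EuclideanSpace ℝ (Fin 3), 2 * ((1 - t) / 6) < ‖x‖ → u t x = 0) := by
    intro t ht0 ht1
    have hs : 0 < 1 - t := sub_pos.2 ht1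
    have hs1 : 1 - t ≤ 1 := by linarith
    have haD : (1 - t) ^ 2 / 24 < (1 - t) / 6 := by nlinarith
    refine ⟨fun x hx => by simp only [hu, if_pos hx], fun x hx1 hx2 => ?_, fun x hx1 hx2 => ?_, fun x hx => ?_⟩
    · have h1 : ¬ ‖x‖ ≤ (1 - t) ^ 2 / 24 := not_le.2 hx1
      have h2 : ¬ ((1 - t) / 6 ≤ ‖x‖ ∧ ‖x‖ ≤ 2 * ((1 - t) / 6)) := fun h => absurd h.1 (not_le.2 hx2)
      simp only [hu, if_neg h1, if_neg h2]
    · have h1 : ¬ ‖x‖ ≤ (1 - t) ^ 2 / 24 := not_le.2 (haD.trans_le hx1)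
      have h2 : (1 - t) / 6 ≤ ‖x‖ ∧ ‖x‖ ≤ 2 * ((1 - t) / 6) := ⟨hx1, hx2⟩
      simp only [hu, if_neg h1, if_pos h2]
    · have h1 : ¬ ‖x‖ ≤ (1 - t) ^ 2 / 24 := not_le.2 (by linarith)
      have h2 : ¬ ((1 - t) / 6 ≤ ‖x‖ ∧ ‖x‖ ≤ 2 * ((1 - t) / 6)) := fun h => absurd h.2 (not_le.2 hx)
      simp only [hu, if_neg h1, if_neg h2]
  -- value at the origin (all `t < 1`)
  have hu0 : ∀ t < (1 : ℝ), u t 0 = ((1 - t)⁻¹ ^ 3) • (eZ : EuclideanSpace ℝ (Fin 3)) := by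
    intro t ht
    have h : ‖(0 : EuclideanSpace ℝ (Fin 3))‖ ≤ (1 - t) ^ 2 / 24 := by rw [norm_zero]; positivity
    simp only [hu, if_pos h, norm_zero, zero_div, sub_zero, max_eq_right zero_le_one, mul_one]
  have hnorm0 : ∀ t < (1 : ℝ), ‖u t 0‖ = (1 - t)⁻¹ ^ 3 := by
    intro t ht
    rw [hu0 t ht, norm_smul, norm_eZ'', mul_one, Real.norm_of_nonneg (by positivity)]
  -- sizes for `0 < t < 1`
  have hsizes : ∀ t : ℝ, 0 < t → t < 1 →
      (∀ x, ‖u t x‖ ≤ (1 - t)⁻¹ ^ 3) ∧ (∀ x, (1 - t) ^ 2 / 24 < ‖x‖ → 3 * ‖u t x‖ ≤ (1 - t)⁻¹ ^ 3) ∧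
        u t 0 = ((1 - t)⁻¹ ^ 3) • (eZ : EuclideanSpace ℝ (Fin 3)) := by
    intro t ht0 ht1
    have hs : 0 < 1 - t := sub_pos.2 ht1
    obtain ⟨f1, f2, f3, f4⟩ := hcl t ht0 ht1
    exact shellSpoiler_sizes (by positivity) (by positivity) f1 f2 f3 f4
  -- the obstruction, packaged: `L (K-1) < (1-t)/3` for every axisymmetric datum, `K ≥ 25`, `0 < t < 1`
  have hobs : ∀ (K t : ℝ), 25 ≤ K → 0 < t → t < 1 →
      ∀ (x₀ : EuclideanSpace ℝ (Fin 3)) (L V : ℝ)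
        (Q : EuclideanSpace ℝ (Fin 3) ≃ₗᵢ[ℝ] EuclideanSpace ℝ (Fin 3))
        (W : EuclideanSpace ℝ (Fin 3) → EuclideanSpace ℝ (Fin 3)),
        0 < L → 0 < V → IsAxisymmetric W → (∀ x, ‖u t x‖ ≤ V) →
        (∃ x₁, dist x₁ x₀ ≤ L ∧ V ≤ 2 * ‖u t x₁‖) →
        (∀ y : EuclideanSpace ℝ (Fin 3), ‖y‖ ≤ K →
          ‖V⁻¹ • Q.symm (u t (x₀ + L • Q y)) - W y‖ ≤ K⁻¹) →
        L * (K - 1) < (1 - t) / 3 ∧ (1 - t)⁻¹ ^ 3 ≤ V := by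
    intro K t hK ht0 ht1 x₀ L V Q W hL hV hW hbd hnear hclose
    have hs : 0 < 1 - t := sub_pos.2 ht1
    obtain ⟨f1, f2, f3, f4⟩ := hcl t ht0 ht1
    have hDa : 4 * ((1 - t) ^ 2 / 24) ≤ (1 - t) / 6 := by nlinarith
    have h := mul_sub_one_lt_of_shellSpoiler (by positivity) (by positivity) hDa f1 f2 f3 f4 hK hL hV hW hbd
      hnear hclose
    refine ⟨by linarith, ?_⟩
    rw [← hnorm0 t ht1]
    exact hbd 0
  refine ⟨u, ?_, ?_, ?_, ?_⟩
  · -- (i) axisymmetric witnesses at every level frequently before `1`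
    intro K hK t₀ ht₀
    set t : ℝ := (max (max t₀ 0) (1 - (24 * K)⁻¹) + 1) / 2 with ht
    have hK24 : 0 < (24 * K)⁻¹ := by positivity
    have hmax_lt : max (max t₀ 0) (1 - (24 * K)⁻¹) < 1 := max_lt (max_lt ht₀ one_pos) (by linarith)
    have ht₀t : t₀ < t := by
      have := (le_max_left t₀ 0).trans (le_max_left (max t₀ 0) (1 - (24 * K)⁻¹)); rw [ht]; linarith
    have ht0 : 0 < t := by
      have := (le_max_right t₀ 0).trans (le_max_left (max t₀ 0) (1 - (24 * K)⁻¹)); rw [ht]; linarith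
    have ht1 : t < 1 := by rw [ht]; linarith
    have hs : 0 < 1 - t := sub_pos.2 ht1
    have hsK : (1 - t) ≤ (24 * K)⁻¹ := by
      have := le_max_right (max t₀ 0) (1 - (24 * K)⁻¹); rw [ht]; linarith
    have hsK' : (1 - t) * K ≤ 24⁻¹ := by
      calc (1 - t) * K ≤ (24 * K)⁻¹ * K := mul_le_mul_of_nonneg_right hsK hK.le
        _ = 24⁻¹ := by field_simp
    obtain ⟨f1, f2, -, -⟩ := hcl t ht0 ht1
    obtain ⟨hbd, -, -⟩ := hsizes t ht0 ht1
    have hG0 : G 0 = eZ := by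
      simp only [hG, norm_zero, sub_zero, max_eq_right zero_le_one, one_smul]
    have hG1 : G (EuclideanSpace.single 0 1) = 0 := by
      simp [hG]
    refine ⟨t, ht₀t, ht1, 0, (1 - t) ^ 2 / 24, (1 - t)⁻¹ ^ 3, LinearIsometryEquiv.refl ℝ _, G,
      by positivity, by positivity, isAxisymmetric_radialCone, hbd, ?_, ?_, ?_, ?_⟩
    · refine ⟨0, by rw [dist_self]; positivity, ?_⟩
      rw [hnorm0 t ht1]; linarith [pow_pos (inv_pos.2 hs) 3]
    · refine ⟨0, EuclideanSpace.single 0 1, by simp, by simp, ?_⟩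
      rw [hG0, hG1, sub_zero, norm_eZ'']
      norm_num
    · -- Reynolds: `K ≤ ((1-t)²/24) (1-t)⁻³ = (24 (1-t))⁻¹`
      have h1 : (1 - t) ^ 2 / 24 * (1 - t)⁻¹ ^ 3 = (24 * (1 - t))⁻¹ := by field_simp
      rw [mul_one, h1, le_inv_comm₀ hK (by positivity)]
      calc 24 * (1 - t) = 24 * ((1 - t) * K) * K⁻¹ := by field_simp
        _ ≤ 24 * 24⁻¹ * K⁻¹ := by
            have := mul_le_mul_of_nonneg_left hsK' (by norm_num : (0:ℝ) ≤ 24)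
            exact mul_le_mul_of_nonneg_right this (inv_nonneg.2 hK.le)
        _ = K⁻¹ := by norm_num
    · intro y hy
      have hrefl : ∀ z : EuclideanSpace ℝ (Fin 3),
          (LinearIsometryEquiv.refl ℝ (EuclideanSpace ℝ (Fin 3))).symm z = z := fun z => rfl
      have hphys : (0 : EuclideanSpace ℝ (Fin 3)) + ((1 - t) ^ 2 / 24) • (LinearIsometryEquiv.refl ℝ _ y) =
          ((1 - t) ^ 2 / 24) • y := by
        simp only [LinearIsometryEquiv.coe_refl, id_eq, zero_add]
      have hnx : ‖((1 - t) ^ 2 / 24) • y‖ = (1 - t) ^ 2 / 24 * ‖y‖ := by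
        rw [norm_smul, Real.norm_of_nonneg (by positivity)]
      rw [hphys, hrefl]
      by_cases hy1 : ‖y‖ ≤ 1
      · have hx : ‖((1 - t) ^ 2 / 24) • y‖ ≤ (1 - t) ^ 2 / 24 := by
          rw [hnx]; exact mul_le_of_le_one_right (by positivity) hy1
        rw [f1 _ hx, smul_smul, ← mul_assoc, inv_mul_cancel₀ (by positivity : (1 - t)⁻¹ ^ 3 ≠ 0), one_mul,
          hnx, mul_div_cancel_left₀ _ (by positivity : (1 - t) ^ 2 / 24 ≠ 0)]
        change ‖max 0 (1 - ‖y‖) • (eZ : EuclideanSpace ℝ (Fin 3)) - G y‖ ≤ K⁻¹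
        rw [sub_self, norm_zero]; positivity
      · push Not at hy1
        have hx1 : (1 - t) ^ 2 / 24 < ‖((1 - t) ^ 2 / 24) • y‖ := by
          rw [hnx]; exact lt_mul_of_one_lt_right (by positivity) hy1
        have hx2 : ‖((1 - t) ^ 2 / 24) • y‖ < (1 - t) / 6 := by
          rw [hnx]
          calc (1 - t) ^ 2 / 24 * ‖y‖ ≤ (1 - t) ^ 2 / 24 * K := mul_le_mul_of_nonneg_left hy (by positivity)
            _ = (1 - t) * ((1 - t) * K) / 24 := by ring
            _ ≤ (1 - t) * 24⁻¹ / 24 := by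
                have := mul_le_mul_of_nonneg_left hsK' hs.le
                linarith
            _ < (1 - t) / 6 := by nlinarith
        rw [f2 _ hx1 hx2, smul_zero, zero_sub, norm_neg]
        change ‖max 0 (1 - ‖y‖) • (eZ : EuclideanSpace ℝ (Fin 3))‖ ≤ K⁻¹
        rw [max_eq_left (by linarith), zero_smul, norm_zero]; positivity
  · -- (ii) faster than the Type-I rate at the origin
    rintro ⟨C, hC⟩
    obtain ⟨l, hl1, hsub⟩ := mem_nhdsLT_iff_exists_Ioo_subset.1 hC
    rw [mem_Iio] at hl1
    set s : ℝ := min ((1 - l) / 2) (|C| + 2)⁻¹ with hsdef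
    have hC2 : 0 < |C| + 2 := by positivity
    have hs0 : 0 < s := lt_min (by linarith) (inv_pos.2 hC2)
    have hsl : s ≤ (1 - l) / 2 := min_le_left _ _
    have hsC : s ≤ (|C| + 2)⁻¹ := min_le_right _ _
    have hmem : 1 - s ∈ Ioo l 1 := ⟨by linarith, by linarith⟩
    have h : ‖u (1 - s) 0‖ ≤ C / Real.sqrt (1 - (1 - s)) := hsub hmem 0
    rw [hnorm0 (1 - s) (by linarith)] at h
    simp only [sub_sub_cancel] at h
    have hsqrt : 0 < Real.sqrt s := Real.sqrt_pos.2 hs0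
    have hs1 : s ≤ 1 := hsC.trans (inv_le_one_of_one_le₀ (by linarith [abs_nonneg C]))
    have hsqrt_ge : s ≤ Real.sqrt s := by
      rw [Real.le_sqrt hs0.le hs0.le]
      nlinarith
    have h2 : s⁻¹ ^ 3 * Real.sqrt s ≤ C := by
      have := mul_le_mul_of_nonneg_right h hsqrt.le
      rwa [div_mul_cancel₀ _ hsqrt.ne'] at this
    have h3 : s⁻¹ ^ 2 ≤ C := by
      calc s⁻¹ ^ 2 = s⁻¹ ^ 3 * s := by field_simp
        _ ≤ s⁻¹ ^ 3 * Real.sqrt s := mul_le_mul_of_nonneg_left hsqrt_ge (by positivity)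
        _ ≤ C := h2
    have h4 : |C| + 2 ≤ s⁻¹ := by
      rw [le_inv_comm₀ hC2 hs0]
      exact hsC
    have h5 : (|C| + 2) ^ 2 ≤ s⁻¹ ^ 2 := pow_le_pow_left₀ hC2.le h4 2
    nlinarith [le_abs_self C, abs_nonneg C]
  · -- (iii) every level-`K` axisymmetric datum (`K ≥ 25`) has small core radius and is not late
    intro K t hK ht0 ht1 x₀ L V Q W hL hV hW hbd hnear hclose
    have hs : 0 < 1 - t := sub_pos.2 ht1
    obtain ⟨hLK, hV'⟩ := hobs K t hK ht0 ht1 x₀ L V Q W hL hV hW hbd hnear hclose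
    have hL72 : L * 24 ≤ L * (K - 1) := mul_le_mul_of_nonneg_left (by linarith) hL.le
    have hKL : K * L < (1 - t) / 2 := by nlinarith
    have h1 : (1 : ℝ) ≤ (1 - t)⁻¹ ^ 3 := one_le_pow₀ (one_le_inv_iff₀.2 ⟨hs, by linarith⟩)
    have h2 : (1 - t) * 1 ≤ (1 - t) * V := mul_le_mul_of_nonneg_left (h1.trans hV') hs.le
    exact ⟨by linarith, by linarith⟩
  · -- (iv) no late level-`25` axisymmetric witnesses at any time after `0`
    intro hlate
    obtain ⟨t, ht0, ht1, x₀, L, V, Q, W, hL, hV, hW, hbd, hnear, -, -, hclose, hl⟩ := hlate 0 one_pos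
    have hs : 0 < 1 - t := sub_pos.2 ht1
    obtain ⟨hLK, hV'⟩ := hobs 25 t le_rfl ht0 ht1 x₀ L V Q W hL hV hW hbd hnear hclose
    have h1 : (1 : ℝ) ≤ (1 - t)⁻¹ ^ 3 := one_le_pow₀ (one_le_inv_iff₀.2 ⟨hs, by linarith⟩)
    have h2 : (1 - t) * 1 ≤ (1 - t) * V := mul_le_mul_of_nonneg_left (h1.trans hV') hs.le
    nlinarith

end MonopoleAnchorObstruction

end Summit.NavierStokesRegularity.NavierStokesRegularity.Theorems

end
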